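import Summits.ABC.IUTFork.Thm311LogKummer
import Summits.ABC.IUTFork.Thm311LogvolInvariance
import HarnessLib

/-!
# [IUTchIII] Cor. 3.12, TEAM B row B-4: Thm 3.11 (ii) (a) — the Kummer-transported holomorphic
# log-volumes AGREE with the mono-analytic log-volume, from lattice-carrying realisations

Record-only file (D-0012) of the abc-iut cell (Cor. 3.12 strategy TEAM B «estimate / log-Kummer» of
HUMAN RULING D-0067 (3), row B-4 of `HOME/plan/C312-TEAMS.md`, seat abc-iut-c312-12 = B2); TAKES NO
SIDE. [IUTchIII] Thm. 3.11 (ii) (a) (kurims p. 155) asserts the Kummer isomorphisms of local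
mono-analytic tensor packets are "all … compatible with the respective log-volumes [cf. Proposition
3.9, (ii)]" — typed by abc-iut-c312-1 as `Column.KummerA C D` (`Thm311LogKummer`): for every `m`, on
`D`-admissible regions the transported holomorphic log-volume `frobLogvol m` is defined and EQUAL to the
mono-analytic `D.logvol`. Step (x) of the proof of Cor. 3.12 and [IUTchIV] Thm. 1.10 Step (v) consume
exactly this equality; TEAM A row A-1 (`Cor312StepXReal`, p411096) takes it as the named hypothesis
`hKumA` of `stepX_holds`.

This file DISCHARGES `KummerA` under the same single-Haar-container reading as row B-2
(`Cor312IndVolumeReal`, abc-iut-c312-d1's `Thm311LogvolInvariance`): if the mono-analytic `D.logvol` /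
`D.Adm` are read through maps `e` into containers with normalised Haar measures, and the column's
`frobAdm m` / `frobLogvol m` are read through the SAME containers pre-composed with a realisation
`ψ m j v_ℚ` of the `m`-th Kummer isomorphism that maps SOME integral structure onto itself ("the Kummer
isomorphism carries the integral structure `𝒪 ⊆ 𝓘^ℚ(−)` to itself", [IUTchIII] Prop. 3.1 (ii) /
Prop. 3.9 (i)(ii); Dupuy–Hilado §4.7 "fixes the lattice"), then:

* `Column.kummerA_of_latticeRealisations` — **`KummerA C D` HOLDS**: on admissible regions the
  `ψ`-transported Haar measure is THE Haar measure (`IntegralStructure.haar_image_of_preserves` — Haar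
  uniqueness), so admissibility transports and the two normalised log-volumes agree;
* `Column.logvolPrecise_of_latticeRealisations` — hence the final "[precisely!]" clause of Thm. 3.11
  (ii) (`LogvolPrecise`, Prop. 3.9 (iv)) holds as well (abc-iut-c312-1's `logvolPrecise_of_kummerA`);
* non-vacuity `example`s: the identity realisation (`ψ m := refl`) satisfies the hypotheses — the
  strictified reading (`frobAdm/frobLogvol :=` the coric data, `Thm311Real3.partII_iff_ind3_of_coric`)
  is the special case, and the hypotheses are strictly more general (any lattice-carrying Kummer
  twist).

SEAM (named, not crossed): WHICH `ψ m` realises the printed Kummer isomorphism at the real carriers is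
the instance data of abc-iut-c312-3's W2-G tensor-packet models / abc-iut-c312-5's `Real.*` instances
(at the one-place level, row B-2's `Real.ismDHHomeoInr`-style witnesses); the log-link half of
Prop. 3.9 (iv) at the genuine `p`-adic logarithm is LANDED as `prop39iv_b_unitLog`
(`PacketLogVolumesLogLink`). Sources read on the page: [IUTchIII] p. 155 (Thm. 3.11 (ii) (a)), pp.
115–117 (Prop. 3.9 (i), (ii), (iv)), pp. 180–181 (Step (x)); Dupuy–Hilado §4.7, §4.9.
[claim: Mochizuki2012, status: disputed] [cite: DupuyHilado2025, §4.7]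
Deliberately NOT here: (ii) (b), (c) (splitting monoids / number fields, rows B-1/B-3), (Ind3) (row
B-3), the closure induction (c312-11), any judgement on Cor. 3.12.
-/

noncomputable section

open MeasureTheory Set
open Literature.IUT.LogVolume

namespace Summit.ABC

namespace IUTFork

namespace Thm311

namespace Column

variable {T : ThetaIndex} {L : LogShells T} (C : Column L) (D : MRData L)
variable {W : T.Label → T.VQ → Type*} [∀ j vQ, AddCommGroup (W j vQ)]
  [∀ j vQ, TopologicalSpace (W j vQ)] [∀ j vQ, IsTopologicalAddGroup (W j vQ)]
  [∀ j vQ, MeasurableSpace (W j vQ)] [∀ j vQ, BorelSpace (W j vQ)]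
  (Λ : ∀ j vQ, IntegralStructure (W j vQ)) (d : T.Label → T.VQ → ℕ)
  (e : ∀ (j : T.Label) (vQ : T.VQ), L.Packet j vQ → W j vQ)
  (ψ : ℤ → ∀ (j : T.Label) (vQ : T.VQ), W j vQ ≃ₜ+ W j vQ)

/-- **[IUTchIII] Thm. 3.11 (ii) (a) (kurims p. 155), real discharge — `KummerA` from lattice-carrying
Kummer realisations**: read the mono-analytic log-volume and admissibility of the data (a) through `e`
into containers with normalised Haar measures (the reading of `Thm311LogvolInvariance`), and the
column's `m`-th transported data through the same containers twisted by a realisation `ψ m` of the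
`m`-th Kummer isomorphism; if each `ψ m j v_ℚ` maps SOME integral structure onto itself ([IUTchIII]
Prop. 3.1 (ii): the Kummer isomorphisms respect the integral structures; Dupuy–Hilado §4.7 "fixes the
lattice"), then on `D`-admissible regions the transported holomorphic log-volume is defined and equals
the mono-analytic one: `C.KummerA D` — "all of which are compatible with the respective log-volumes
[cf. Proposition 3.9, (ii)]". By Haar uniqueness (`IntegralStructure.haar_image_of_preserves`): a
lattice-carrying homeomorphism preserves every normalised Haar measure.
[claim: Mochizuki2012, status: disputed] -/
theorem kummerA_of_latticeRealisations
    (hlogvol : ∀ (j : T.Label) (vQ : T.VQ) (A : Set (L.Packet j vQ)),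
      D.logvol j vQ A = (Λ j vQ).normalizedLogVolume (d j vQ) (e j vQ '' A))
    (hAdm : ∀ (j : T.Label) (vQ : T.VQ) (A : Set (L.Packet j vQ)),
      D.Adm j vQ A ↔ 0 < (Λ j vQ).haar (e j vQ '' A) ∧ (Λ j vQ).haar (e j vQ '' A) < ⊤)
    (hψ : ∀ (m : ℤ) (j : T.Label) (vQ : T.VQ), ∃ Λ₀ : IntegralStructure (W j vQ),
      ψ m j vQ '' (Λ₀ : Set (W j vQ)) = (Λ₀ : Set (W j vQ)))
    (hfrobAdm : ∀ (m : ℤ) (j : T.Label) (vQ : T.VQ) (A : Set (L.Packet j vQ)),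
      C.frobAdm m j vQ A ↔ 0 < (Λ j vQ).haar (ψ m j vQ '' (e j vQ '' A)) ∧
        (Λ j vQ).haar (ψ m j vQ '' (e j vQ '' A)) < ⊤)
    (hfrobLogvol : ∀ (m : ℤ) (j : T.Label) (vQ : T.VQ) (A : Set (L.Packet j vQ)),
      C.frobLogvol m j vQ A = (Λ j vQ).normalizedLogVolume (d j vQ) (ψ m j vQ '' (e j vQ '' A))) :
    C.KummerA D := by
  intro m j vQ A hA
  obtain ⟨Λ₀, hΛ₀⟩ := hψ m j vQ
  have hhaar : (Λ j vQ).haar (ψ m j vQ '' (e j vQ '' A)) = (Λ j vQ).haar (e j vQ '' A) :=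
    (Λ j vQ).haar_image_of_preserves (ψ m j vQ) Λ₀ hΛ₀ _
  constructor
  · rw [hfrobAdm, hhaar]
    exact (hAdm j vQ A).mp hA
  · rw [hfrobLogvol, hlogvol,
      (Λ j vQ).normalizedLogVolume_image_of_preserves (d j vQ) (ψ m j vQ) Λ₀ hΛ₀]

/-- Hence the final "[precisely!]" clause of Thm. 3.11 (ii) — `LogvolPrecise` ([IUTchIII] p. 156,
Prop. 3.9 (iv): "as one varies `m ∈ ℤ`, the isomorphisms of (a) are [precisely!] compatible … with the
respective log-volumes") — holds under the same hypotheses (abc-iut-c312-1's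
`logvolPrecise_of_kummerA`). [claim: Mochizuki2012, status: disputed] -/
theorem logvolPrecise_of_latticeRealisations
    (hlogvol : ∀ (j : T.Label) (vQ : T.VQ) (A : Set (L.Packet j vQ)),
      D.logvol j vQ A = (Λ j vQ).normalizedLogVolume (d j vQ) (e j vQ '' A))
    (hAdm : ∀ (j : T.Label) (vQ : T.VQ) (A : Set (L.Packet j vQ)),
      D.Adm j vQ A ↔ 0 < (Λ j vQ).haar (e j vQ '' A) ∧ (Λ j vQ).haar (e j vQ '' A) < ⊤)
    (hψ : ∀ (m : ℤ) (j : T.Label) (vQ : T.VQ), ∃ Λ₀ : IntegralStructure (W j vQ),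
      ψ m j vQ '' (Λ₀ : Set (W j vQ)) = (Λ₀ : Set (W j vQ)))
    (hfrobAdm : ∀ (m : ℤ) (j : T.Label) (vQ : T.VQ) (A : Set (L.Packet j vQ)),
      C.frobAdm m j vQ A ↔ 0 < (Λ j vQ).haar (ψ m j vQ '' (e j vQ '' A)) ∧
        (Λ j vQ).haar (ψ m j vQ '' (e j vQ '' A)) < ⊤)
    (hfrobLogvol : ∀ (m : ℤ) (j : T.Label) (vQ : T.VQ) (A : Set (L.Packet j vQ)),
      C.frobLogvol m j vQ A = (Λ j vQ).normalizedLogVolume (d j vQ) (ψ m j vQ '' (e j vQ '' A))) :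
    C.LogvolPrecise D :=
  C.logvolPrecise_of_kummerA D
    (C.kummerA_of_latticeRealisations D Λ d e ψ hlogvol hAdm hψ hfrobAdm hfrobLogvol)

/-- NON-VACUITY of the realisation hypothesis: the identity realisation maps every integral structure
onto itself — the strictified reading (`frobAdm`/`frobLogvol` := the coric data read through `e`) is
the special case `ψ m := refl`, so the hypotheses of `kummerA_of_latticeRealisations` are satisfiable
whenever a container exists. [folklore] -/
example (j : T.Label) (vQ : T.VQ) (Λ₀ : IntegralStructure (W j vQ)) :
    (ContinuousAddEquiv.refl (W j vQ)) '' (Λ₀ : Set (W j vQ)) = (Λ₀ : Set (W j vQ)) := by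
  simp

end Column

end Thm311

end IUTFork

end Summit.ABC

end
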